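import Summits.QuantumFields.GaugeBoot.Rows.GLYZc2D4LTab
import HarnessLib

/-!
# Gauge-boot: kernel check of the raw `link1` class table of the glyz-c2-4D problems, rows 0–19 (part 1/10)

Cell `pub-gaugeboot` (HOME `run/shared/lean/pub/pub-gaugeboot/`), seat lean1 (torus layer for rows C76–C87 = the certified
glyz-c2-4D windows: label set, raw blocks, class/witness tables, the reduction identity, per-β bindings).

HONEST FRAMING (page 1 of every file of this cell): certified bounds on lattice expectations at STATED coupling,
gauge group, dimension and torus size; NOT a mass gap, NOT a continuum limit, NOT a string tension, NOT large `N`.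
The venture is explicitly NOT Yang–Mills-summit-bearing (barriers `FixedCouplingUltralocality`,
`PerturbativeInvisibility`).

`lcanon_rows_<lo>_<hi> : ∀ i, lo ≤ i < hi → ∀ j ≥ i, GLYZc2D4.LCanonOK i j`, each range one closed computation (`decide +kernel`);
assembled in `GLYZc2D4Canon`.
-/

noncomputable section

open Literature.MathematicalPhysics.QuantumFieldTheory

namespace Summit.QuantumFields.GaugeBoot

namespace GLYZc2D4

set_option maxHeartbeats 0 in
/-- Rows `0 ≤ i < 4` of the `link1` class table of the glyz-c2-4D problems canonicalise (1338 entries; kernel). -/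
theorem lcanon_rows_0_4 : ∀ i : Fin 336, 0 ≤ i.val → i.val < 4 → ∀ j : Fin 336, i.val ≤ j.val → GLYZc2D4.LCanonOK i j := by
  decide +kernel

set_option maxHeartbeats 0 in
/-- Rows `4 ≤ i < 8` of the `link1` class table of the glyz-c2-4D problems canonicalise (1322 entries; kernel). -/
theorem lcanon_rows_4_8 : ∀ i : Fin 336, 4 ≤ i.val → i.val < 8 → ∀ j : Fin 336, i.val ≤ j.val → GLYZc2D4.LCanonOK i j := by
  decide +kernel

set_option maxHeartbeats 0 in
/-- Rows `8 ≤ i < 12` of the `link1` class table of the glyz-c2-4D problems canonicalise (1306 entries; kernel). -/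
theorem lcanon_rows_8_12 : ∀ i : Fin 336, 8 ≤ i.val → i.val < 12 → ∀ j : Fin 336, i.val ≤ j.val → GLYZc2D4.LCanonOK i j := by
  decide +kernel

set_option maxHeartbeats 0 in
/-- Rows `12 ≤ i < 16` of the `link1` class table of the glyz-c2-4D problems canonicalise (1290 entries; kernel). -/
theorem lcanon_rows_12_16 : ∀ i : Fin 336, 12 ≤ i.val → i.val < 16 → ∀ j : Fin 336, i.val ≤ j.val → GLYZc2D4.LCanonOK i j := by
  decide +kernel

set_option maxHeartbeats 0 in
/-- Rows `16 ≤ i < 20` of the `link1` class table of the glyz-c2-4D problems canonicalise (1274 entries; kernel). -/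
theorem lcanon_rows_16_20 : ∀ i : Fin 336, 16 ≤ i.val → i.val < 20 → ∀ j : Fin 336, i.val ≤ j.val → GLYZc2D4.LCanonOK i j := by
  decide +kernel

end GLYZc2D4

end Summit.QuantumFields.GaugeBoot

end
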